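import Literature.AlgebraicGeometry.Resolution.NeronPopescuLiftSolution
import Literature.AlgebraicGeometry.Resolution.NeronPopescuArtinianStep
import Literature.AlgebraicGeometry.Resolution.NeronPopescu07FEAlgebra
import Literature.AlgebraicGeometry.Resolution.NeronPopescuImprovePresentation
import Literature.AlgebraicGeometry.Resolution.NeronPopescuOgoma
import Mathlib.RingTheory.Ideal.KrullsHeightTheorem
import HarnessLib

/-!
# Stacks 07FE holds: the separable residue field case of Popescu's theorem

Topic: `Literature/AlgebraicGeometry/Resolution`. Discharge of the named fact
`Stacks07FE_resolveSpecial` (`NeronPopescuSteps.lean`; The Stacks Project, *Smoothing Ring Maps*,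
Lemma 07FE):
> Let `k → A → Λ ⊃ 𝔮` be as in Situation 07F7 where (1) `k` is a field, (2) `Λ` is Noetherian,
> (3) `𝔮` is minimal over `𝔥_A`, (4) `Λ_𝔮` is a regular local ring, and (5) the field extension
> `κ(𝔮)/k` is separable. Then `k → A → Λ ⊃ 𝔮` can be resolved.
> *Proof.* Set `d = dim Λ_𝔮`. Set `R = k[x_1, …, x_d]`. Choose `n > 0` such that
> `𝔮ⁿΛ_𝔮 ⊂ 𝔥_AΛ_𝔮` … Choose generators `a_1, …, a_r` of `H_{A/R}`. Set
> `B = A[x_1, …, x_d, z_{ij}]/(x_iⁿ - Σ z_{ij}a_j)`. Each `B_{a_j}` is smooth over `R` … Hence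
> `B_{x_i}` is smooth over `R`. Let `B → C` be the `R`-algebra map constructed in Lemma 07CE which
> comes with a `R`-algebra retraction `C → B`. … we can find `c > 0` such that `x_i^c` is strictly
> standard in `C/R`, see Lemma 07EZ. Now choose `π_1, …, π_d ∈ Λ` as in Lemma 07FD where `n = n`,
> `e = 8c`, `𝔮 = 𝔮` and `I = 𝔥_A`. Write `π_iⁿ = Σ λ_{ij} a_j` … There is a map `B → Λ` given by
> `x_i ↦ π_i` and `z_{ij} ↦ λ_{ij}`. … Now we apply Lemma 07F8 to `R → C → Λ ⊃ 𝔮` and the sequence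
> of elements `x_1^c, …, x_d^c` of `R`. Assumption (2) is clear. Assumption (1) holds for `R` by
> inspection and for `Λ` by our choice of `π_1, …, π_d`. … Thus it suffices to resolve
> `R/(x_1^e, …, x_d^e) → C/(x_1^e, …, x_d^e) → Λ/(π_1^e, …, π_d^e) ⊃ 𝔮/(π_1^e, …, π_d^e)` for
> `e = 8c`. By Lemma 07FA it suffices to resolve this after localizing at `𝔮`. But … `R_𝔭 → Λ_𝔮`
> is flat … a flat ring map of Artinian local rings … separable field extension on residue fields …
> a filtered colimit of smooth algebras by Algebra, Lemma 00MP and Proposition 07CM. …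
`Stacks07FE_resolveSpecial_holds` PROVES the fact along exactly these lines from the pieces proved
in the sibling files: `NeronPopescu07FEAlgebra.lean` (`B`, `B_{x_i}` smooth),
`NeronPopescuImprovePresentation.lean` (07CE), `StrictlyStandardPowers.lean` (07EZ),
`NeronPopescuOgoma.lean` (07FD, with `I = H_{A/k}Λ`), `NeronPopescuLiftSolution.lean` (07F8,
07F0, hence 07CP, 07CT, 07CR), `NeronPopescuArtinianStep.lean` (`Stacks07FE_endgame`: 07FA,
07F9, 00MP/07BV, 07CM; if `𝔥 ⊄ 𝔮̄` at the quotient level the identity factorisation already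
resolves), and the passage from the base `R = k[x]` to `k` (`R` smooth over `k`, the `a_j`
remain in the singular ideals along `A → B → C`). "By inspection" is `mem_span_pow_of_X_pow_mul_mem`
(a variable is a non-zero-divisor modulo a monomial ideal in the other variables). No named facts;
the fact `Stacks07FE_resolveSpecial` stays a `def … : Prop` and is now discharged.

## References

* The Stacks Project, *Smoothing Ring Maps* (Tag 07BW), Lemma 07FE and its proof, with Lemmas
  07CE, 07EZ, 07FD, 07F8, 07FA and Proposition 07CM. [StacksProject]
-/


noncomputable section

namespace Literature.AlgebraicGeometry.Resolution

open MvPolynomial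

universe u
/-! ## Stacks 07FE: assembly of the proof -/

namespace Stacks07FEProof

/-- **"Assumption (1) holds for `R` by inspection"**: in `k[x]`, `x_i` is a non-zero-divisor modulo
the monomial ideal `(x_j^E : j ∈ S)` for `i ∉ S`. [cite: StacksProject, Tag 07FE (proof)] -/
theorem mem_span_pow_of_X_mul_mem {σ : Type*} {K : Type*} [CommRing K] (S : Set σ) (E : ℕ)
    (i : σ) (hi : i ∉ S) (f : MvPolynomial σ K)
    (h : X i * f ∈ Ideal.span ((fun j => X j ^ E) '' S)) :
    f ∈ Ideal.span ((fun j => X j ^ E) '' S) := by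
  classical
  have hset : (fun j : σ => (X j ^ E : MvPolynomial σ K)) '' S =
      (fun s => monomial s (1 : K)) '' ((fun j => Finsupp.single j E) '' S) := by
    rw [Set.image_image]
    refine Set.image_congr fun j _ => ?_
    rw [X_pow_eq_monomial]
  rw [hset, mem_ideal_span_monomial_image] at h ⊢
  intro m hm
  have hm' : Finsupp.single i 1 + m ∈ (X i * f).support := by
    rw [support_X_mul]
    exact Finset.mem_map_of_mem _ hm
  obtain ⟨si, ⟨j, hj, rfl⟩, hle⟩ := h _ hm'
  refine ⟨Finsupp.single j E, ⟨j, hj, rfl⟩, ?_⟩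
  have hji : j ≠ i := fun h => hi (h ▸ hj)
  rw [Finsupp.single_le_iff] at hle ⊢
  rwa [Finsupp.add_apply, Finsupp.single_eq_of_ne hji, zero_add] at hle

/-- Powers version: `x_i^m f ∈ (x_j^E : j ∈ S) ⇒ f ∈ (x_j^E : j ∈ S)` for `i ∉ S`. [folklore] -/
theorem mem_span_pow_of_X_pow_mul_mem {σ : Type*} {K : Type*} [CommRing K] (S : Set σ) (E : ℕ)
    (i : σ) (hi : i ∉ S) (m : ℕ) (f : MvPolynomial σ K)
    (h : X i ^ m * f ∈ Ideal.span ((fun j => X j ^ E) '' S)) :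
    f ∈ Ideal.span ((fun j => X j ^ E) '' S) := by
  induction m generalizing f with
  | zero => simpa using h
  | succ m ih =>
    refine ih f (mem_span_pow_of_X_mul_mem S E i hi _ ?_)
    rw [← mul_assoc, ← pow_succ']
    exact h

end Stacks07FEProof

open Stacks07FEProof Stacks07F8 IsLocalRing in
set_option maxHeartbeats 1600000 in
/-- **Stacks, Lemma 07FE holds** (`Stacks07FE_resolveSpecial`, `NeronPopescuSteps.lean`): for
`k → A → Λ ⊃ 𝔮` with `k` a field, `A` of finite presentation, `Λ` Noetherian, `𝔮` minimal over
`𝔥_A`, `Λ_𝔮` regular and `κ(𝔮)/k` separable, `k → A → Λ ⊃ 𝔮` can be resolved. The proof is the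
printed one: `d = dim Λ_𝔮`, `R = k[x_1, …, x_d]`, `n` with `𝔮ⁿΛ_𝔮 ⊆ H_{A/k}Λ_𝔮`, generators `a_j` of
`H_{A/k}`, the algebra `B = A[x, z_{ij}]/(x_iⁿ - Σ z_{ij} a_j)` (`NeronPopescu07FEAlgebra.lean`) with
`B_{x_i}` smooth over `R`, the improved `C` of Lemma 07CE (`Stacks07CE_exists_symmetricAlgebra`) with
`C_{x_i}` smooth and `Ω` free, `c` with `x_i^c` strictly standard in `C` (Lemma 07EZ,
`Stacks07EZ_isStrictlyStandard_pow_of_free`), `π_1, …, π_d ∈ Λ` from Lemma 07FD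
(`exists_parameters_pow_mem_ann_eq`, with `I = H_{A/k}Λ`, `e = 8c`), `B → Λ` by `x_i ↦ π_i`,
`z_{ij} ↦ λ_{ij}`, Lemma 07F8 for `R → C → Λ ⊃ 𝔮` and the `x_i^c` (`canResolve_of_canResolve_level`,
assumption (1) for `R` "by inspection" = `mem_span_pow_of_X_pow_mul_mem`), and the resolution of
`R/(x^e) → C/(x^e) → Λ/(π^e) ⊃ 𝔮/(π^e)` by Lemma 07FA, Algebra 00MP/07BV and Proposition 07CM
(`Stacks07FE_endgame`, `NeronPopescuArtinianStep.lean`; when `𝔥 ⊄ 𝔮̄` already, the identity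
factorisation resolves). Finally a resolution over `R` is one over `k` because `R` is smooth over `k`
and the `a_j` stay in the singular ideals along `A → B → C`. [cite: StacksProject, Tag 07FE] -/
theorem Stacks07FE_resolveSpecial_holds : Stacks07FE_resolveSpecial.{u} := by
  intro k A Λ _ _ _ _ _ hAfp hΛ φ q _ hqmin hreg hsep
  classical
  haveI := hAfp
  haveI := hΛ
  haveI := hreg
  set Λq := Localization.AtPrime q with hΛq
  haveI : IsNoetherianRing Λq := IsLocalization.isNoetherianRing q.primeCompl Λq inferInstance
  -- `d = dim Λ_𝔮`
  have hfinh : (maximalIdeal Λq).height ≠ ⊤ :=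
    Ideal.height_ne_top (IsLocalRing.maximalIdeal.isMaximal Λq).ne_top
  obtain ⟨d, hd⟩ : ∃ d : ℕ, ringKrullDim Λq = d := by
    refine ⟨(maximalIdeal Λq).height.toNat, ?_⟩
    rw [← IsLocalRing.maximalIdeal_height_eq_ringKrullDim, ← ENat.coe_toNat hfinh]
    rfl
  -- generators `a_j` of `H_{A/k}`
  haveI : IsNoetherianRing A := Algebra.FiniteType.isNoetherianRing k A
  obtain ⟨r, a, ha⟩ : ∃ (r : ℕ) (a : Fin r → A), Ideal.span (Set.range a) = singularIdeal k A :=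
    Submodule.fg_iff_exists_fin_generating_family.mp (IsNoetherian.noetherian _)
  have hasm : ∀ j, Algebra.Smooth k (Localization.Away (a j)) := fun j =>
    mem_singularIdeal_iff_smooth.mp (ha ▸ Ideal.subset_span ⟨j, rfl⟩)
  -- `n` with `𝔮ⁿ Λ_𝔮 ⊆ H_{A/k} Λ_𝔮`
  set HΛ : Ideal Λ := (singularIdeal k A).map φ with hHΛ
  obtain ⟨n, hnpos, hn⟩ : ∃ n, 0 < n ∧
      (q ^ n).map (algebraMap Λ Λq) ≤ HΛ.map (algebraMap Λ Λq) := by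
    have hrad : maximalIdeal Λq ≤ (HΛ.map (algebraMap Λ Λq)).radical := by
      rw [Ideal.radical_eq_sInf]
      refine le_sInf ?_
      rintro P ⟨hHP, hP⟩
      haveI := hP
      have hP'q : P.comap (algebraMap Λ Λq) ≤ q := by
        have hPm : P ≤ maximalIdeal Λq := IsLocalRing.le_maximalIdeal hP.ne_top
        calc P.comap (algebraMap Λ Λq) ≤ (maximalIdeal Λq).comap (algebraMap Λ Λq) :=
              Ideal.comap_mono hPm
          _ = q := IsLocalization.AtPrime.under_maximalIdeal Λq q
      have hHP' : hIdeal k φ ≤ P.comap (algebraMap Λ Λq) := by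
        refine (Ideal.IsPrime.radical_le_iff (hP.comap _)).mpr ?_
        rw [← Ideal.map_le_iff_le_comap]
        exact hHP
      have hqP' : q ≤ P.comap (algebraMap Λ Λq) := hqmin.2 ⟨hP.comap _, hHP'⟩ hP'q
      calc maximalIdeal Λq = q.map (algebraMap Λ Λq) := (Localization.AtPrime.map_eq_maximalIdeal).symm
        _ ≤ (P.comap (algebraMap Λ Λq)).map (algebraMap Λ Λq) := Ideal.map_mono hqP'
        _ ≤ P := Ideal.map_comap_le
    obtain ⟨n, hn⟩ := Ideal.exists_pow_le_of_le_radical_of_fg hrad (IsNoetherian.noetherian _)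
    refine ⟨n + 1, Nat.succ_pos n, ?_⟩
    rw [Ideal.map_pow, Localization.AtPrime.map_eq_maximalIdeal]
    exact (Ideal.pow_le_pow_right (Nat.le_succ n)).trans hn
  -- the algebra `B` over `R = k[x_1, …, x_d]` and the improved `C`
  set R := MvPolynomial (Fin d) k with hR
  haveI : Algebra.FinitePresentation R (Stacks07FE.B a n d) := Stacks07FE.finitePresentation a n d
  obtain ⟨C, _, _, toC, σC, hCfp, hσ, hCsm⟩ :=
    Stacks07CE_exists_symmetricAlgebra R (Stacks07FE.B a n d)
  haveI := hCfp
  -- `c` with `x_i^c` strictly standard in `C`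
  have hpow : ∀ i : Fin d, ∃ e₀ : ℕ, ∀ e, e₀ ≤ e →
      IsStrictlyStandard R (toC (Stacks07FE.var a n d (Sum.inl i)) ^ e) := fun i => by
    obtain ⟨h1, h2⟩ := hCsm _ (Stacks07FE.smooth_away_var_inl hasm i)
    haveI := h1
    haveI := h2
    exact Stacks07EZ_isStrictlyStandard_pow_of_free _
  choose e₀ he₀ using hpow
  set c : ℕ := Finset.univ.sup e₀ + 1 with hc_def
  have hc : 0 < c := Nat.succ_pos _
  have hce : ∀ i, e₀ i ≤ c := fun i => (Finset.le_sup (Finset.mem_univ i)).trans (Nat.le_succ _)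
  have halgX : ∀ i, algebraMap R C (X i) = toC (Stacks07FE.var a n d (Sum.inl i)) := fun i => by
    rw [← toC.commutes, Stacks07FE.algebraMap_mvPolynomial, aeval_X]
  let ϖ : Fin d → R := fun i => X i ^ c
  have hss : ∀ i, IsStrictlyStandard R (algebraMap R C (ϖ i)) := fun i => by
    change IsStrictlyStandard R (algebraMap R C (X i ^ c))
    rw [map_pow, halgX]
    exact he₀ i c (hce i)
  -- `π_1, …, π_d` (Lemma 07FD with `I = H_{A/k}Λ`, `e = 8c`)
  obtain ⟨π, hπmax, hπn, hπann⟩ := exists_parameters_pow_mem_ann_eq HΛ q hnpos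
    (show 0 < c * 8 by omega) hn hd
  have hπq : ∀ i, π i ∈ q := fun i => by
    rw [← IsLocalization.AtPrime.to_map_mem_maximal_iff Λq q, ← hπmax]
    exact Ideal.mem_map_of_mem _ (Ideal.subset_span ⟨i, rfl⟩)
  -- `λ_{ij}` with `π_iⁿ = Σ λ_{ij} a_j`, and `B → Λ`
  have hlam : ∀ i, ∃ cf : Fin r → Λ, ∑ j, cf j * φ (a j) = π i ^ n := fun i => by
    have : π i ^ n ∈ Ideal.span (Set.range (φ ∘ a)) := by
      rw [Set.range_comp, ← Ideal.map_span, ha]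
      exact hπn i
    exact Ideal.mem_span_range_iff_exists_fun.mp this
  choose lam hlam using hlam
  have hπeq : ∀ i, π i ^ n = ∑ j, lam i j * φ (a j) := fun i => (hlam i).symm
  let liftB : Stacks07FE.B a n d →ₐ[k] Λ := Stacks07FE.lift φ π lam hπeq
  letI algΛ : Algebra R Λ := (aeval π : R →ₐ[k] Λ).toRingHom.toAlgebra
  have halgΛ : ∀ p : R, algebraMap R Λ p = aeval π p := fun _ => rfl
  haveI : IsScalarTower k R Λ := IsScalarTower.of_algebraMap_eq fun x => by
    rw [halgΛ, MvPolynomial.algebraMap_eq, aeval_C]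
  let liftR : Stacks07FE.B a n d →ₐ[R] Λ :=
    ⟨liftB.toRingHom, fun p => by
      change liftB (algebraMap R (Stacks07FE.B a n d) p) = algebraMap R Λ p
      rw [Stacks07FE.lift_algebraMap_mvPolynomial, halgΛ]⟩
  have hliftR : ∀ b, liftR b = liftB b := fun _ => rfl
  let φC : C →ₐ[R] Λ := liftR.comp σC
  have hφC : ∀ x, φC x = liftB (σC x) := fun _ => rfl
  -- hypotheses of Lemma 07F8 for `ϖ_i = x_i^c`
  have hϖΛ : ∀ i, algebraMap R Λ (ϖ i) = π i ^ c := fun i => by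
    change algebraMap R Λ (X i ^ c) = _
    rw [halgΛ, map_pow, aeval_X]
  have hq8 : ∀ j, algebraMap R Λ (ϖ j) ∈ q := fun j => by
    rw [hϖΛ]
    exact Ideal.pow_mem_of_mem q (hπq j) c hc
  have hJJ : ∀ i : Fin d, JJ ϖ i = Ideal.span ((fun j : Fin d => X j ^ (c * 8)) '' {j | (j : ℕ) < i}) := by
    intro i
    rw [JJ]
    congr 1
    refine Set.image_congr fun j _ => ?_
    change (X j ^ c) ^ 8 = X j ^ (c * 8)
    rw [← pow_mul]
  have hRann : ∀ (i : Fin d) (y : R), ϖ i ^ 2 * y ∈ JJ ϖ i → ϖ i * y ∈ JJ ϖ i := by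
    intro i y hy
    rw [hJJ] at hy ⊢
    have hi : i ∉ {j : Fin d | (j : ℕ) < i} := fun h => lt_irrefl (i : ℕ) h
    refine Ideal.mul_mem_left _ _ (mem_span_pow_of_X_pow_mul_mem _ _ i hi (c * 2) y ?_)
    have : ϖ i ^ 2 = X i ^ (c * 2) := by change (X i ^ c) ^ 2 = _; rw [← pow_mul]
    rwa [this] at hy
  have hϖ8 : ∀ j, algebraMap R Λ (ϖ j ^ 8) = π j ^ (c * 8) := fun j => by
    rw [map_pow, hϖΛ, ← pow_mul]
  have hJJΛ : ∀ i : Fin d, (JJ ϖ i).map (algebraMap R Λ) =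
      Ideal.span ((fun j => π j ^ (c * 8)) '' Set.Iio i) := by
    intro i
    rw [JJ, Ideal.map_span, Set.image_image]
    congr 1
    ext x
    simp only [Set.mem_image, Set.mem_setOf_eq, Set.mem_Iio, Fin.lt_def, hϖ8]
  have hΛann : ∀ (i : Fin d) (y : Λ), algebraMap R Λ (ϖ i) ^ 2 * y ∈ (JJ ϖ i).map (algebraMap R Λ) →
      algebraMap R Λ (ϖ i) * y ∈ (JJ ϖ i).map (algebraMap R Λ) := by
    intro i y hy
    rw [hJJΛ, hϖΛ] at hy ⊢
    have h1 : π i * y ∈ Ideal.span ((fun j => π j ^ (c * 8)) '' Set.Iio i) := by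
      refine pow_mul_mem_imp_of_sq (hπann i) (show 0 < c * 2 by omega) y ?_
      rwa [← pow_mul] at hy
    have : π i ^ c * y = π i ^ (c - 1) * (π i * y) := by
      rw [← mul_assoc, ← pow_succ, Nat.sub_add_cancel hc]
    rw [this]
    exact Ideal.mul_mem_left _ _ h1
  -- the level-`d` resolution (Lemma 07FA & Proposition 07CM: `Stacks07FE_endgame`)
  haveI : Algebra.FinitePresentation (Rl ϖ d) (Cl ϖ d (C := C)) :=
    finitePresentation_quotient (JJ ϖ d) (JJ_fg ϖ d)
  have hbase : CanResolve (Rl ϖ d) (φl ϖ φC d) (ql ϖ q d) := by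
    by_cases hle : hIdeal (Rl ϖ d) (φl ϖ φC d) ≤ ql ϖ q d
    · have hXmem : ∀ j, (X j : R) ∈ MvPolynomial.idealOfVars (Fin d) k := fun j =>
        Ideal.subset_span ⟨j, rfl⟩
      have hI₂ : JJ ϖ d ≤ MvPolynomial.idealOfVars (Fin d) k := by
        rw [JJ, Ideal.span_le]
        rintro _ ⟨j, -, rfl⟩
        change (X j ^ c) ^ 8 ∈ MvPolynomial.idealOfVars (Fin d) k
        rw [← pow_mul]
        exact Ideal.pow_mem_of_mem _ (hXmem j) _ (by omega)
      have hfg : (MvPolynomial.idealOfVars (Fin d) k).FG :=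
        ⟨Finset.univ.image X, by rw [Finset.coe_image, Finset.coe_univ, Set.image_univ]⟩
      have hrad' : MvPolynomial.idealOfVars (Fin d) k ≤ (JJ ϖ d).radical := by
        rw [MvPolynomial.idealOfVars, Ideal.span_le]
        rintro _ ⟨j, rfl⟩
        exact ⟨c * 8, Ideal.subset_span ⟨j, j.2, by change (X j ^ c) ^ 8 = _; rw [← pow_mul]⟩⟩
      obtain ⟨M, hM⟩ : ∃ M, MvPolynomial.idealOfVars (Fin d) k ^ M ≤ JJ ϖ d :=
        Ideal.exists_pow_le_of_le_radical_of_fg hrad' hfg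
      have hπ' : Ideal.span (Set.range fun i => algebraMap Λ Λq (algebraMap R Λ (X i))) =
          maximalIdeal Λq := by
        have hfun : (fun i => algebraMap Λ Λq (algebraMap R Λ (X i))) = (algebraMap Λ Λq) ∘ π :=
          funext fun i => by rw [Function.comp_apply, halgΛ, aeval_X]
        rw [hfun, Set.range_comp, ← Ideal.map_span, hπmax]
      exact Stacks07FE_endgame q hd hπ' hsep (JJ ϖ d) M hM hI₂ (Cl ϖ d (C := C)) (φl ϖ φC d) hle
    · exact ⟨Cl ϖ d, inferInstance, inferInstance, inferInstance, AlgHom.id _ _, φl ϖ φC d,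
        AlgHom.comp_id _, le_rfl, hle⟩
  -- Lemma 07F8
  have hres : CanResolve R φC q :=
    canResolve_of_canResolve_level ϖ φC q hq8 hRann hΛann hss hbase
  -- from `R` to `k`
  obtain ⟨B', _, _, hB'fp, v, w, hwv, hincl, hnot⟩ := hres
  haveI := hB'fp
  letI : Algebra k B' := ((algebraMap R B').comp (algebraMap k R)).toAlgebra
  haveI : IsScalarTower k R B' := IsScalarTower.of_algebraMap_eq fun _ => rfl
  haveI : Algebra.FinitePresentation k B' := Algebra.FinitePresentation.trans k R B'
  letI : Algebra k C := ((algebraMap R C).comp (algebraMap k R)).toAlgebra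
  haveI : IsScalarTower k R C := IsScalarTower.of_algebraMap_eq fun _ => rfl
  let toCk : A →ₐ[k] C := (toC.restrictScalars k).comp (IsScalarTower.toAlgHom k A (Stacks07FE.B a n d))
  let v' : A →ₐ[k] B' := (v.restrictScalars k).comp toCk
  let w' : B' →ₐ[k] Λ := w.restrictScalars k
  have hmapw : ∀ I : Ideal B', I.map w = I.map w' := fun _ => rfl
  have hHB' : singularIdeal R B' ≤ singularIdeal k B' := fun b hb => by
    rw [mem_singularIdeal_iff_smooth] at hb ⊢
    haveI := hb
    haveI : Algebra.Smooth k R := {}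
    exact Algebra.Smooth.comp k R (Localization.Away b)
  have hφa : ∀ j, φC (toC (algebraMap A (Stacks07FE.B a n d) (a j))) = φ (a j) := fun j => by
    rw [hφC, hσ, Stacks07FE.lift_algebraMap]
  refine ⟨B', inferInstance, inferInstance, inferInstance, v', w', ?_, ?_, ?_⟩
  · refine AlgHom.ext fun x => ?_
    change w (v (toC (algebraMap A (Stacks07FE.B a n d) x))) = φ x
    rw [← AlgHom.comp_apply w v, hwv, hφC, hσ, Stacks07FE.lift_algebraMap]
  · show ((singularIdeal k A).map φ).radical ≤ ((singularIdeal k B').map w').radical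
    refine Ideal.radical_le_radical_iff.mpr ?_
    rw [← ha, Ideal.map_span, Ideal.span_le]
    rintro _ ⟨_, ⟨j, rfl⟩, rfl⟩
    have h1 : toC (algebraMap A (Stacks07FE.B a n d) (a j)) ∈ singularIdeal R C := by
      rw [mem_singularIdeal_iff_smooth]
      exact (hCsm _ (Stacks07FE.smooth_away_algebraMap j (hasm j))).1
    have h2 : φC (toC (algebraMap A (Stacks07FE.B a n d) (a j))) ∈ hIdeal R w :=
      hincl (Ideal.le_radical (Ideal.mem_map_of_mem _ h1))
    rw [hφa] at h2
    rw [SetLike.mem_coe]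
    refine Ideal.radical_mono ?_ h2
    rw [hmapw]
    exact Ideal.map_mono hHB'
  · intro hle
    apply hnot
    refine le_trans (Ideal.radical_mono ?_) hle
    rw [hmapw]
    exact Ideal.map_mono hHB'

end Literature.AlgebraicGeometry.Resolution

end
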